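/-
Copyright (c) 2026 the pub-hodgecm-mathlib formalisation cell (harness21).  Prover seat hodgecm-mathlib-K2E3-p21 (g5), Track B «K2-LIT» ∕ h413
(`stmt-HodgeConjecture-24833`), line `K2_E3_EllipticInputs`, unit U12 §L, road «GL-[M6]-sc» (line lead K2E3-p23 (g5), RULINGS #11 (M11-3): T20-GL₃ co-owned with
K2E5-p17 (g4); contract 2026-09-04T07:09:09Z «you = Iwahori ∕ conjugation + cusp transport»), brick T20-GL₃ (B-Iw), FILE 3: «THE CUSP-FORM PROPERTY OF SUPERCUSPIDAL
COEFFICIENTS ALONG THE CONJUGATE RADICALS `w U_c w⁻¹` (all Weyl chambers) AND ALONG ANY SUBGROUP EQUAL TO A RADICAL».  2026-09-04.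
-/
import Summits.HodgeConjecture.HodgeConjecture.Theorems.K2E3GL3SupercuspidalCuspFormOppositeRadicals   -- ★ B4-J FILE 4 p858109 (this seat): transport lemma, general labels, opposite radicals
import HarnessLib

/-!
# K2_E3 road (h413), T20-GL₃ input (B-Iw) 3: `∫_{wUw⁻¹} θ(x v y) dν(v) = 0` for supercuspidal coefficients `θ` of `GL_n(F)` along every conjugate `w U_c w⁻¹` of a unipotent
# radical (and its opposite), for every Haar measure — the `hcusp` inputs of ★ (A)∕(A′) `K2E3CuspFormCancellationPolychotomy{,Transport}` over all `W × ι` directions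

Cell `pub/hodgecm-mathlib` (D-0151), Track B, seat K2E3-p21 (g5); T20-GL₃ co-owner K2E5-p17 (g4) («(A′) … output over `W × ι` from BASE data + `hcusp` along the conjugates»,
conjugate subgroups in the currency `Subgroup.map (MulAut.conj w).toMonoidHom`, `w = permGL σ`); line lead K2E3-p23 (g5).  `--supports stmt-HodgeConjecture-24833 --as helper`;
THEOREMS ONLY (no definition ∕ instance ∕ notation ∕ named-fact hypothesis ∕ `sorry`).

* §1 GENERIC: `exists_continuousMulEquiv_map_conj` (`N ≃ₜ* wNw⁻¹` by conjugation, any topological group), `exists_continuousMulEquiv_of_eq` (`H₁ = H₂ ⇒ H₁ ≃ₜ* H₂` over the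
  identity), and `integral_translate_eq_zero_of_continuousMulEquiv_of_coe_eq` (★ FILE 4 §1's transport for `w = 1`: the cusp condition along EQUAL subgroups written with
  different labels — e.g. `Fin 2` vs `Bool` vs `toDual ∘ c`, ★ (B-Iw) FILE 1 `unipotentRadicalGL_eq_of_forall_le_iff`).
* §2 `GL_n(F)`, `π` smooth SUPERCUSPIDAL, `B` `π`-invariant, `c : Fin n → α` proper monotone (`α` any finite linear order), ANY `w ∈ GL_n(F)`, EVERY Haar `ν`:
  **`integral_matrixCoeff_sesqForm_translate_map_conj_unipotentRadicalGL_eq_zero`** (`∀ x y u u', ∫_{wU_cw⁻¹} c_{B u',u}(x v y) dν(v) = 0`), its OPPOSITE twin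
  **`…_map_conj_unipotentRadicalGL_opposite_eq_zero`** (`c₂ = c₁ ∘ rev`), the EQUAL-SUBGROUP readings `…_of_eq_unipotentRadicalGL…`, and the `G_Λ` pull-backs for the
  road's `θ̃ = θ ∘ π_Λ` (`ρ` smooth supercuspidal on `GL₃(F) ⧸ Λ·1`, ★ FILE 3 `isSupercuspidal_comp_mk'_quotScalar`).
[HarishChandra1970, Part I §3 p. 9 (cusp forms: `∫_N f(x n y) dn = 0` for the unipotent radical of EVERY parabolic), Part VII §8]; [Casselman1995, Thm. 5.3.1, Prop. 1.4.4].

HONEST LABEL: HC_CM is proved only modulo the 7 printed citations (2 remaining named inputs: hLiu418 = `stmt-HodgeConjecture-24832`, h413 = `stmt-HodgeConjecture-24833`)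
until rung 0 closes; this file is a count-neutral helper and closes no socket.

## References
* [HarishChandra1970] Harish-Chandra (notes by G. van Dijk), *Harmonic Analysis on Reductive p-adic Groups*, LNM 162 (1970), Part I §3 p. 9; Part VII §8 pp. 80–84.
* [Casselman1995] W. Casselman, *Introduction to the theory of admissible representations of `p`-adic reductive groups* (1995 notes), Prop. 1.4.4, Thm. 5.3.1.
* [Rogawski1990] J. D. Rogawski, *Automorphic Representations of Unitary Groups in Three Variables*, Ann. of Math. Stud. 123 (1990), §4.13 p. 70.
-/

set_option autoImplicit false
-- the mandated namespace repeats the single-problem summit's segment (`HodgeConjecture.HodgeConjecture`)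
set_option linter.dupNamespace false

noncomputable section

open Set Filter Topology MeasureTheory
open scoped MatrixGroups Pointwise
open Literature.NumberTheory.Automorphic Literature.NumberTheory.GaloisRepresentations Literature.NumberTheory.GaloisRepresentations.IsNonarchimedeanLocalField
open Summit.HodgeConjecture.HodgeConjecture.Cruxes.H413.K2E3GL3SupercuspidalJacquetVanishing
open Summit.HodgeConjecture.HodgeConjecture.Cruxes.H413.K2E3GL3SupercuspidalCuspFormOppositeRadicals

namespace Summit.HodgeConjecture.HodgeConjecture.Cruxes.H413.K2E3GL3SupercuspidalCuspFormConjRadicals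

/-! ## §1  Generic isomorphisms and the `w = 1` transport -/

section Generic

variable {G : Type*} [Group G] [TopologicalSpace G] [IsTopologicalGroup G]

/-- **`N ≃ₜ* wNw⁻¹` by conjugation** (`Subgroup.map (MulAut.conj w)`), with `↑(e n) = w n w⁻¹`. [folklore] -/
theorem exists_continuousMulEquiv_map_conj (N : Subgroup G) (w : G) :
    ∃ e : ↥N ≃ₜ* ↥(N.map (MulAut.conj w).toMonoidHom), ∀ n : ↥N, ((e n : ↥(N.map (MulAut.conj w).toMonoidHom)) : G) = w * (n : G) * w⁻¹ := by
  have hmem : ∀ n : ↥N, w * (n : G) * w⁻¹ ∈ N.map (MulAut.conj w).toMonoidHom := fun n => Subgroup.mem_map.2 ⟨n, n.2, rfl⟩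
  have hmem' : ∀ m : ↥(N.map (MulAut.conj w).toMonoidHom), w⁻¹ * (m : G) * w ∈ N := fun m => by
    obtain ⟨n, hn, hnm⟩ := Subgroup.mem_map.1 m.2
    rw [← hnm, MulEquiv.coe_toMonoidHom, MulAut.conj_apply, show w⁻¹ * (w * n * w⁻¹) * w = n by group]
    exact hn
  set f : ↥N → ↥(N.map (MulAut.conj w).toMonoidHom) := fun n => ⟨w * (n : G) * w⁻¹, hmem n⟩ with hf
  set g : ↥(N.map (MulAut.conj w).toMonoidHom) → ↥N := fun m => ⟨w⁻¹ * (m : G) * w, hmem' m⟩ with hg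
  have hf_coe : ∀ n, ((f n : ↥(N.map (MulAut.conj w).toMonoidHom)) : G) = w * (n : G) * w⁻¹ := fun n => rfl
  have hg_coe : ∀ m, ((g m : ↥N) : G) = w⁻¹ * (m : G) * w := fun m => rfl
  have hgf : Function.LeftInverse g f := fun n => Subtype.ext (by rw [hg_coe, hf_coe]; group)
  have hfg : Function.RightInverse g f := fun m => Subtype.ext (by rw [hf_coe, hg_coe]; group)
  have hmul : ∀ a b, f (a * b) = f a * f b := fun a b => Subtype.ext (by rw [Subgroup.coe_mul, hf_coe, hf_coe, hf_coe, Subgroup.coe_mul]; group)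
  have hfc : Continuous f := Continuous.subtype_mk ((continuous_const.mul continuous_subtype_val).mul continuous_const) _
  have hgc : Continuous g := Continuous.subtype_mk ((continuous_const.mul continuous_subtype_val).mul continuous_const) _
  exact ⟨{ toFun := f, invFun := g, left_inv := hgf, right_inv := hfg, map_mul' := hmul, continuous_toFun := hfc, continuous_invFun := hgc }, fun n => rfl⟩

omit [IsTopologicalGroup G] in
/-- **Equal subgroups are isomorphic topological groups over the identity** (`MulEquiv.subgroupCongr`). [folklore] -/
theorem exists_continuousMulEquiv_of_eq {H₁ H₂ : Subgroup G} (h : H₁ = H₂) :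
    ∃ e : ↥H₁ ≃ₜ* ↥H₂, ∀ u : ↥H₁, ((e u : ↥H₂) : G) = (u : G) := by
  subst h
  exact ⟨ContinuousMulEquiv.refl _, fun _ => rfl⟩

variable (H₁ H₂ : Subgroup G) [MeasurableSpace ↥H₁] [BorelSpace ↥H₁] [MeasurableSpace ↥H₂] [BorelSpace ↥H₂] {E : Type*} [NormedAddCommGroup E] [NormedSpace ℝ E]

/-- **TRANSPORT OF THE CUSP CONDITION OVER THE IDENTITY** (`↑(e u) = ↑u`, e.g. `H₁ = H₂` written with different labels): ★ FILE 4 §1 with `w = 1`. [cite: HarishChandra1970, Part I §3 p. 9] -/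
theorem integral_translate_eq_zero_of_continuousMulEquiv_of_coe_eq (e : ↥H₁ ≃ₜ* ↥H₂) (he : ∀ u : ↥H₁, ((e u : ↥H₂) : G) = (u : G))
    (θ : G → E) (h₁ : ∀ (ν₁ : Measure ↥H₁), ν₁.IsHaarMeasure → ∀ x y : G, ∫ u, θ (x * (u : G) * y) ∂ν₁ = 0)
    (ν₂ : Measure ↥H₂) [ν₂.IsHaarMeasure] (x y : G) : ∫ v, θ (x * (v : G) * y) ∂ν₂ = 0 :=
  integral_translate_eq_zero_of_continuousMulEquiv H₁ H₂ 1 e (fun u => by rw [he, one_mul, inv_one, mul_one]) θ h₁ ν₂ x y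

/-- **THE CUSP CONDITION ALONG EQUAL SUBGROUPS** (`H₁ = H₂`). [cite: HarishChandra1970, Part I §3 p. 9] -/
theorem integral_translate_eq_zero_of_eq (h : H₁ = H₂) (θ : G → E)
    (h₁ : ∀ (ν₁ : Measure ↥H₁), ν₁.IsHaarMeasure → ∀ x y : G, ∫ u, θ (x * (u : G) * y) ∂ν₁ = 0)
    (ν₂ : Measure ↥H₂) [ν₂.IsHaarMeasure] (x y : G) : ∫ v, θ (x * (v : G) * y) ∂ν₂ = 0 := by
  obtain ⟨e, he⟩ := exists_continuousMulEquiv_of_eq (G := G) h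
  exact integral_translate_eq_zero_of_continuousMulEquiv_of_coe_eq H₁ H₂ e he θ h₁ ν₂ x y

/-- **THE CUSP CONDITION ALONG A CONJUGATE SUBGROUP `wHw⁻¹`** from the cusp condition along `H` (every Haar measure). [cite: HarishChandra1970, Part I §3 p. 9, Part VII §8] -/
theorem integral_translate_map_conj_eq_zero (H : Subgroup G) [MeasurableSpace ↥H] [BorelSpace ↥H] (w : G)
    [MeasurableSpace ↥(H.map (MulAut.conj w).toMonoidHom)] [BorelSpace ↥(H.map (MulAut.conj w).toMonoidHom)] (θ : G → E)
    (h₁ : ∀ (ν₁ : Measure ↥H), ν₁.IsHaarMeasure → ∀ x y : G, ∫ u, θ (x * (u : G) * y) ∂ν₁ = 0)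
    (ν₂ : Measure ↥(H.map (MulAut.conj w).toMonoidHom)) [ν₂.IsHaarMeasure] (x y : G) : ∫ v, θ (x * (v : G) * y) ∂ν₂ = 0 := by
  obtain ⟨e, he⟩ := exists_continuousMulEquiv_map_conj H w
  exact integral_translate_eq_zero_of_continuousMulEquiv H _ w e he θ h₁ ν₂ x y

end Generic

/-! ## §2  `GL_n(F)`: supercuspidal coefficients along `w U_c w⁻¹`, its opposite, and equal subgroups -/

section GLn

variable {F : Type*} [Field F] [ValuativeRel F] [TopologicalSpace F] [IsNonarchimedeanLocalField F] {n : ℕ} [NeZero n]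
  {V : Type*} [AddCommGroup V] [Module ℂ V] (π : Representation ℂ (GL (Fin n) F) V) {α : Type*} [LinearOrder α] [Fintype α]
  {B : V →ₗ⋆[ℂ] V →ₗ[ℂ] ℂ}

/-- **`∫_{wU_cw⁻¹} c_{B u',u}(x v y) dν(v) = 0`** for `π` smooth supercuspidal, `B` `π`-invariant, `c` proper monotone, ANY `w ∈ GL_n(F)` (e.g. ★ `permGL σ`, the Weyl chambers)
and EVERY Haar measure `ν` of `↥(U_c.map (MulAut.conj w))` — the `hcusp` of ★ (A)∕(A′) along the conjugate radical (`π.matrixCoeff (B u') u g = B u' (π g u)`, ★ `matrixCoeff_apply`).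
[cite: HarishChandra1970, Part I §3 p. 9, Part VII §8] [cite: Casselman1995, Thm. 5.3.1] -/
theorem integral_matrixCoeff_sesqForm_translate_map_conj_unipotentRadicalGL_eq_zero (hπ : π.IsSmooth) (hsc : π.IsSupercuspidal)
    {c : Fin n → α} (hc : IsProperBlocks c) (hcm : Monotone c) (w : GL (Fin n) F)
    [MeasurableSpace ↥((unipotentRadicalGL F c).map (MulAut.conj w).toMonoidHom)] [BorelSpace ↥((unipotentRadicalGL F c).map (MulAut.conj w).toMonoidHom)]
    (ν : Measure ↥((unipotentRadicalGL F c).map (MulAut.conj w).toMonoidHom)) [ν.IsHaarMeasure]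
    (hBinv : ∀ (g : GL (Fin n) F) (v w : V), B (π g v) (π g w) = B v w) (x y : GL (Fin n) F) (u u' : V) :
    ∫ v, π.matrixCoeff (B u') u (x * (v : GL (Fin n) F) * y) ∂ν = 0 := by
  borelize ↥(unipotentRadicalGL F c)
  exact integral_translate_map_conj_eq_zero (unipotentRadicalGL F c) w (π.matrixCoeff (B u') u)
    (fun ν₁ hν₁ x' y' => by
      haveI := hν₁
      exact integral_matrixCoeff_sesqForm_translate_unipotentRadicalGL_eq_zero π ν₁ hπ hsc hc hcm hBinv x' y' u u') ν x y

/-- **The OPPOSITE twin: `∫_{wU_{c₂}w⁻¹} c_{B u',u}(x v y) dν(v) = 0`** for `c₂ = c₁ ∘ rev`, `c₁` proper monotone (★ FILE 4 `…_opposite_eq_zero` transported).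
[cite: HarishChandra1970, Part I §3 p. 9, Part VII §8] [cite: Casselman1995, Thm. 5.3.1] -/
theorem integral_matrixCoeff_sesqForm_translate_map_conj_unipotentRadicalGL_opposite_eq_zero (hπ : π.IsSmooth) (hsc : π.IsSupercuspidal)
    {c₁ c₂ : Fin n → α} (hc : IsProperBlocks c₁) (hcm : Monotone c₁) (hrev : ∀ i, c₂ i = c₁ (Fin.rev i)) (w : GL (Fin n) F)
    [MeasurableSpace ↥((unipotentRadicalGL F c₂).map (MulAut.conj w).toMonoidHom)] [BorelSpace ↥((unipotentRadicalGL F c₂).map (MulAut.conj w).toMonoidHom)]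
    (ν : Measure ↥((unipotentRadicalGL F c₂).map (MulAut.conj w).toMonoidHom)) [ν.IsHaarMeasure]
    (hBinv : ∀ (g : GL (Fin n) F) (v w : V), B (π g v) (π g w) = B v w) (x y : GL (Fin n) F) (u u' : V) :
    ∫ v, π.matrixCoeff (B u') u (x * (v : GL (Fin n) F) * y) ∂ν = 0 := by
  borelize ↥(unipotentRadicalGL F c₂)
  exact integral_translate_map_conj_eq_zero (unipotentRadicalGL F c₂) w (π.matrixCoeff (B u') u)
    (fun ν₁ hν₁ x' y' => by
      haveI := hν₁
      exact integral_sesqForm_apply_translate_unipotentRadicalGL_opposite_eq_zero π ν₁ hπ hsc hc hcm hrev hBinv x' y' u u') ν x y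

/-- **EQUAL-SUBGROUP READING**: for ANY subgroup `H = U_c` (e.g. the same radical written with `Bool`, `Fin 2` or `toDual` labels — ★ (B-Iw) FILE 1
`unipotentRadicalGL_eq_of_forall_le_iff`), `∫_H c_{B u',u}(x v y) dν(v) = 0` for every Haar `ν` of `↥H`. [cite: HarishChandra1970, Part I §3 p. 9] -/
theorem integral_matrixCoeff_sesqForm_translate_of_eq_unipotentRadicalGL_eq_zero (hπ : π.IsSmooth) (hsc : π.IsSupercuspidal)
    {c : Fin n → α} (hc : IsProperBlocks c) (hcm : Monotone c) {H : Subgroup (GL (Fin n) F)} (hH : unipotentRadicalGL F c = H)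
    [MeasurableSpace ↥H] [BorelSpace ↥H] (ν : Measure ↥H) [ν.IsHaarMeasure]
    (hBinv : ∀ (g : GL (Fin n) F) (v w : V), B (π g v) (π g w) = B v w) (x y : GL (Fin n) F) (u u' : V) :
    ∫ v, π.matrixCoeff (B u') u (x * (v : GL (Fin n) F) * y) ∂ν = 0 := by
  borelize ↥(unipotentRadicalGL F c)
  exact integral_translate_eq_zero_of_eq (unipotentRadicalGL F c) H hH (π.matrixCoeff (B u') u)
    (fun ν₁ hν₁ x' y' => by
      haveI := hν₁
      exact integral_matrixCoeff_sesqForm_translate_unipotentRadicalGL_eq_zero π ν₁ hπ hsc hc hcm hBinv x' y' u u') ν x y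

/-- **EQUAL-SUBGROUP READING, OPPOSITE**: for ANY subgroup `H = U_{c₂}`, `c₂ = c₁ ∘ rev` (e.g. `H = unipotentRadicalGL F (toDual ∘ c₁')` for the matching two-block `c₁'`,
★ (B-Iw) FILE 1 dictionary): `∫_H c_{B u',u}(x v y) dν = 0`. [cite: HarishChandra1970, Part I §3 p. 9] -/
theorem integral_matrixCoeff_sesqForm_translate_of_eq_unipotentRadicalGL_opposite_eq_zero (hπ : π.IsSmooth) (hsc : π.IsSupercuspidal)
    {c₁ c₂ : Fin n → α} (hc : IsProperBlocks c₁) (hcm : Monotone c₁) (hrev : ∀ i, c₂ i = c₁ (Fin.rev i)) {H : Subgroup (GL (Fin n) F)}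
    (hH : unipotentRadicalGL F c₂ = H) [MeasurableSpace ↥H] [BorelSpace ↥H] (ν : Measure ↥H) [ν.IsHaarMeasure]
    (hBinv : ∀ (g : GL (Fin n) F) (v w : V), B (π g v) (π g w) = B v w) (x y : GL (Fin n) F) (u u' : V) :
    ∫ v, π.matrixCoeff (B u') u (x * (v : GL (Fin n) F) * y) ∂ν = 0 := by
  borelize ↥(unipotentRadicalGL F c₂)
  exact integral_translate_eq_zero_of_eq (unipotentRadicalGL F c₂) H hH (π.matrixCoeff (B u') u)
    (fun ν₁ hν₁ x' y' => by
      haveI := hν₁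
      exact integral_sesqForm_apply_translate_unipotentRadicalGL_opposite_eq_zero π ν₁ hπ hsc hc hcm hrev hBinv x' y' u u') ν x y

end GLn

/-! ## §3  The road's pull-backs `θ̃ = θ ∘ π_Λ` on `GL₃(F)` along the conjugate radicals -/

section GL3PullBack

variable {F : Type*} [Field F] [ValuativeRel F] [TopologicalSpace F] [IsNonarchimedeanLocalField F] [CharZero F] (Λ₀ : Subgroup Fˣ)
  [(Λ₀.map (Matrix.GeneralLinearGroup.scalar (Fin 3))).Normal] {V : Type*} [AddCommGroup V] [Module ℂ V]
  (ρ : Representation ℂ (GL (Fin 3) F ⧸ Λ₀.map (Matrix.GeneralLinearGroup.scalar (Fin 3))) V) {α : Type*} [LinearOrder α] [Fintype α]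
  {B : V →ₗ⋆[ℂ] V →ₗ[ℂ] ℂ}

/-- **PULL-BACK ALONG `wU_cw⁻¹`**: for `ρ` smooth supercuspidal on `G_Λ = GL₃(F) ⧸ Λ·1` (any `Λ₀`), `B` `ρ`-invariant, `c : Fin 3 → α` proper monotone, any `w`, every Haar `ν`
of `↥(U_c.map (conj w))`, all `x y`: `∫ B u' (ρ(π_Λ(x v y)) u) dν(v) = 0`. [cite: HarishChandra1970, Part I §3 p. 9, Part VII §3, §8] [cite: Casselman1995, Thm. 5.3.1] -/
theorem integral_sesqForm_apply_translate_map_conj_unipotentRadicalGL_comp_mk_eq_zero (hρ : ρ.IsSmooth) (hsc : ρ.IsSupercuspidal)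
    {c : Fin 3 → α} (hc : IsProperBlocks c) (hcm : Monotone c) (w : GL (Fin 3) F)
    [MeasurableSpace ↥((unipotentRadicalGL F c).map (MulAut.conj w).toMonoidHom)] [BorelSpace ↥((unipotentRadicalGL F c).map (MulAut.conj w).toMonoidHom)]
    (ν : Measure ↥((unipotentRadicalGL F c).map (MulAut.conj w).toMonoidHom)) [ν.IsHaarMeasure]
    (hBinv : ∀ (g : GL (Fin 3) F ⧸ Λ₀.map (Matrix.GeneralLinearGroup.scalar (Fin 3))) (v w : V), B (ρ g v) (ρ g w) = B v w)
    (x y : GL (Fin 3) F) (u u' : V) :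
    ∫ v, B u' (ρ (QuotientGroup.mk (x * (v : GL (Fin 3) F) * y)) u) ∂ν = 0 :=
  integral_matrixCoeff_sesqForm_translate_map_conj_unipotentRadicalGL_eq_zero (ρ.comp (QuotientGroup.mk' (Λ₀.map (Matrix.GeneralLinearGroup.scalar (Fin 3)))))
    ((isSmooth_comp_mk'_iff _ ρ).2 hρ) (isSupercuspidal_comp_mk'_quotScalar Λ₀ ρ hsc) hc hcm w ν (fun _ v w => hBinv _ v w) x y u u'

/-- **PULL-BACK ALONG `wU_{c₂}w⁻¹`, OPPOSITE** (`c₂ = c₁ ∘ rev`). [cite: HarishChandra1970, Part I §3 p. 9, Part VII §8] [cite: Casselman1995, Thm. 5.3.1] -/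
theorem integral_sesqForm_apply_translate_map_conj_unipotentRadicalGL_opposite_comp_mk_eq_zero (hρ : ρ.IsSmooth) (hsc : ρ.IsSupercuspidal)
    {c₁ c₂ : Fin 3 → α} (hc : IsProperBlocks c₁) (hcm : Monotone c₁) (hrev : ∀ i, c₂ i = c₁ (Fin.rev i)) (w : GL (Fin 3) F)
    [MeasurableSpace ↥((unipotentRadicalGL F c₂).map (MulAut.conj w).toMonoidHom)] [BorelSpace ↥((unipotentRadicalGL F c₂).map (MulAut.conj w).toMonoidHom)]
    (ν : Measure ↥((unipotentRadicalGL F c₂).map (MulAut.conj w).toMonoidHom)) [ν.IsHaarMeasure]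
    (hBinv : ∀ (g : GL (Fin 3) F ⧸ Λ₀.map (Matrix.GeneralLinearGroup.scalar (Fin 3))) (v w : V), B (ρ g v) (ρ g w) = B v w)
    (x y : GL (Fin 3) F) (u u' : V) :
    ∫ v, B u' (ρ (QuotientGroup.mk (x * (v : GL (Fin 3) F) * y)) u) ∂ν = 0 :=
  integral_matrixCoeff_sesqForm_translate_map_conj_unipotentRadicalGL_opposite_eq_zero (ρ.comp (QuotientGroup.mk' (Λ₀.map (Matrix.GeneralLinearGroup.scalar (Fin 3)))))
    ((isSmooth_comp_mk'_iff _ ρ).2 hρ) (isSupercuspidal_comp_mk'_quotScalar Λ₀ ρ hsc) hc hcm hrev w ν (fun _ v w => hBinv _ v w) x y u u'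

end GL3PullBack

end Summit.HodgeConjecture.HodgeConjecture.Cruxes.H413.K2E3GL3SupercuspidalCuspFormConjRadicals

end
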